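import Summits.BirchSwinnertonDyer.BirchSwinnertonDyer.Theorems.OneSidedTwistSqueezeX9KatoDivisibilityX9ReciprocityPkQTerm
import Summits.BirchSwinnertonDyer.BirchSwinnertonDyer.Theorems.SmallImageMuTransferMuTransferX9StepFourCocycleSeams
import HarnessLib

set_option autoImplicit false

-- the summit and its single problem are both named `BirchSwinnertonDyer` (registry layout D-0017)
set_option linter.dupNamespace false

/-!
# Crux `KatoDivisibilityX9` (20547), line `graded_euler_loss`, stub `stub_reciprocityPkAX9` (1c′), file F: THE LEVEL-`p^k`
# LOCAL VANISHING THEOREM `hLocalPk` — STEP 4 + Lemma 1 (iii) joined for `𝒯_J^{(k)}` at `J = 2p^m k`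

Seat `bsd-line-k6-p4` (prover-bsd-line-k6-p4-g6-0, 6th LEAD). THEOREMS ONLY; `--supports 20547` helper, closes nothing.
* §0 `exists_monic_rel` — for `J = 2p^m k`, `k ≥ 1`: a MONIC `g` of degree `J − p^m` and `h` with `g·ω + p^k·h = X^J`
  (`ω = (X+1)^{p^m} − 1`; `g = X^J /ₘ ω`, the remainder being `≡ 0 (mod p^k)` by `…Division.exists_omega_sq_rel`).
* §1 `exists_unit_qTermIdentityPk` — the `hQ` ADAPTER (twin of koly's `LocalSplitPrime.exists_unit_qTermIdentity`): file E's
  identity instantiated at the local classes `loc_q[c]` (transverse) and `loc_q(T^ε[Ψc])` (unramified), in the shape of the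
  hypothesis `hQ` of `…KolyvaginReciprocityPkStepFour.convCoeff_eq_zero_of_qTermIdentityPk`.
* §2 **`localPk`** — VERBATIM the hypothesis `hLocalPk` of `…KolyvaginReciprocityPkOfLocal.kolyvaginReciprocityPk_of_localPk`
  (the level-`p^k` twin of koly's `LocalSplitPrime.convCoeff_eq_zero_of_transverse_of_unramified`, with the extra level hypothesis
  `J = 2p^m k`): Poitou–Tate (`convCoeff_eq_zero_of_qTermIdentityPk`) + §1.  Hence `hKolyRecPk`, hence the registered stub (next file).

References: Mazur–Rubin, Mem. AMS 799 (2004) Prop. 1.3.2, §4.4 [MazurRubin2004]; Milne, ADT (2006) I Thm. 4.10(b) [MilneADT2006];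
Rubin, PCMI 18 (2011) Prop. 1.9.5 [Rubin2011]; Washington, GTM 83, §7.1–7.2 [Washington1997].
-/

noncomputable section

open scoped Classical ContRepresentation

universe u

namespace Summit.BirchSwinnertonDyer.BirchSwinnertonDyer.Theorems.OneSidedTwistSqueezeX9KatoDivisibilityX9ReciprocityPkLocal

open CategoryTheory ContinuousCohomology Function Field ValuativeRel NumberField IsDedekindDomain Finset Polynomial
open Literature.NumberTheory.GaloisRepresentations
open Literature.NumberTheory.GaloisRepresentations.IsNonarchimedeanLocalField
open Literature.NumberTheory.GaloisRepresentations.DiscreteGaloisModule (mu MuCarrier)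
open _root_.TopRep
open Literature.NumberTheory.GaloisCohomology
open Literature.NumberTheory.EllipticCurves
open Literature.NumberTheory.EllipticCurves.ZpExtension
open Summit.BirchSwinnertonDyer.Rank1Residual.GaloisImage
open Summit.BirchSwinnertonDyer.Rank1Residual (X11b.LocBridge.mem_unramifiedSubgroup_one_iff_forall_eq_zero)
open Summit.BirchSwinnertonDyer.BirchSwinnertonDyer.Rank1Residual
open Summit.BirchSwinnertonDyer.BirchSwinnertonDyer.Rank1Residual.LocalSplitPrime
open Summit.BirchSwinnertonDyer.BirchSwinnertonDyer.Theorems.OneSidedTwistSqueezeX9KatoDivisibilityX9KolyvaginReciprocityPkStepFour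
open Summit.BirchSwinnertonDyer.BirchSwinnertonDyer.Theorems.OneSidedTwistSqueezeX9KatoDivisibilityX9KolyvaginReciprocityPkDivision
  (exists_omega_sq_rel)
open Summit.BirchSwinnertonDyer.BirchSwinnertonDyer.Theorems.OneSidedTwistSqueezeX9KatoDivisibilityX9ReciprocityPkQTerm

/-! ## §0 The monic relation `g·ω + p^k·h = X^J` at `J = 2p^m k` -/

section MonicRel

/-- **For `J = 2p^m k`, `k ≥ 1`, there are `g` MONIC of degree `J − p^m` and `h` with `g·ω + p^k·h = X^J`**, `ω = (X+1)^{p^m} − 1`: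
`g = X^J /ₘ ω`, and the remainder `X^J %ₘ ω` vanishes modulo `p^k` because `X^J = m·ω² + p^k·h₀` (`exists_omega_sq_rel`).
[cite: Washington1997, §7.1–§7.2] -/
theorem exists_monic_rel {p : ℕ} (hp : p.Prime) (m k : ℕ) (hk : 1 ≤ k) :
    ∃ g h : ℤ[X], g.Monic ∧ p ^ m + g.natDegree = 2 * p ^ m * k ∧
      g * ((X + 1 : ℤ[X]) ^ p ^ m - 1) + ((p ^ k : ℕ) : ℤ[X]) * h = X ^ (2 * p ^ m * k) := by
  obtain ⟨hωmon, hωdeg, -⟩ := monic_omega hp m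
  set ω : ℤ[X] := (X + 1 : ℤ[X]) ^ p ^ m - 1 with hω
  set J := 2 * p ^ m * k with hJ
  obtain ⟨m₀, h₀, hrel₀⟩ := exists_omega_sq_rel hp m (k - 1)
  rw [Nat.sub_add_cancel hk] at hrel₀
  haveI : Fact (1 < p ^ k) := ⟨Nat.one_lt_pow (by omega) hp.one_lt⟩
  -- the remainder of `X^J` modulo `ω` vanishes modulo `p^k`
  have hmod : ((X : ℤ[X]) ^ J %ₘ ω).map (Int.castRingHom (ZMod (p ^ k))) = 0 := by
    rw [map_modByMonic _ hωmon, Polynomial.map_pow, map_X]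
    have hX : (X : (ZMod (p ^ k))[X]) ^ J = 0 + ω.map (Int.castRingHom (ZMod (p ^ k))) *
        (m₀.map (Int.castRingHom (ZMod (p ^ k))) * ω.map (Int.castRingHom (ZMod (p ^ k)))) := by
      have h := congrArg (Polynomial.map (Int.castRingHom (ZMod (p ^ k)))) hrel₀
      simp only [Polynomial.map_add, Polynomial.map_mul, Polynomial.map_pow, Polynomial.map_natCast, map_X] at h
      have hz : ((p : (ZMod (p ^ k))[X])) ^ k = 0 := by
        rw [← C_eq_natCast, ← C_pow, ← Nat.cast_pow, ZMod.natCast_self, C_0]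
      rw [hz, zero_mul, add_zero] at h
      rw [zero_add, ← h]
      ring
    exact (div_modByMonic_unique _ _ (hωmon.map _) ⟨hX.symm, by rw [degree_zero]; exact Ne.bot_lt (fun h =>
      (hωmon.map (Int.castRingHom (ZMod (p ^ k)))).ne_zero (degree_eq_bot.1 h))⟩).2
  -- hence `X^J %ₘ ω = C (p^k) * h`
  have hdvd : ∀ i, ((p ^ k : ℕ) : ℤ) ∣ ((X : ℤ[X]) ^ J %ₘ ω).coeff i := fun i => by
    have h := congrArg (fun P => P.coeff i) hmod
    simp only [coeff_map, coeff_zero, eq_intCast] at h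
    exact (ZMod.intCast_zmod_eq_zero_iff_dvd _ _).1 h
  obtain ⟨h, hh⟩ := (C_dvd_iff_dvd_coeff _ _).2 hdvd
  have hdegle : ω.degree ≤ ((X : ℤ[X]) ^ J).degree := by
    rw [degree_eq_natDegree hωmon.ne_zero, hωdeg, degree_X_pow]
    exact_mod_cast (by nlinarith [Nat.one_le_pow m p hp.pos] : p ^ m ≤ J)
  refine ⟨(X : ℤ[X]) ^ J /ₘ ω, h, ?_, ?_, ?_⟩
  · rw [Monic, leadingCoeff_divByMonic_of_monic hωmon hdegle, leadingCoeff_X_pow]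
  · rw [natDegree_divByMonic _ hωmon, natDegree_X_pow, hωdeg]
    have : p ^ m ≤ J := by nlinarith [Nat.one_le_pow m p hp.pos]
    omega
  · rw [mul_comm, ← C_eq_natCast, ← hh, add_comm, modByMonic_add_div]

end MonicRel

/-! ## §1 The `hQ` adapter at level `p^k` -/

section Adapter

variable {K : Type u} [Field K] [NumberField K] {p : ℕ} [Fact p.Prime] {k₀ : ℕ}
  {M M' : Type u} [AddCommGroup M] [TopologicalSpace M] [DiscreteTopology M] [Finite M]
  [AddCommGroup M'] [TopologicalSpace M'] [DiscreteTopology M'] [Finite M']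
  (ρ : DiscreteGaloisModule K M) (ρ' : DiscreteGaloisModule K M')
  (hM : ∀ x : M, p ^ k₀ • x = 0) (hM' : ∀ x : M', p ^ k₀ • x = 0) (κ : ZpExtension K p) (J : ℕ)
  (q : HeightOneSpectrum (𝓞 K)) [Fact (Ideal.absNorm q.asIdeal).Prime]
  [NeZero ((Ideal.absNorm q.asIdeal : ℕ) : q.adicCompletion K)]
  [LocallyCompactSpace (absoluteGaloisGroup (Place.Completion (Sum.inr q : Place K)))]

set_option maxHeartbeats 800000 in
/-- **The `hQ` adapter at level `p^k`**: file E's identity at the local classes `loc_q [c]` (transverse) and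
`loc_q (T^ε [Ψc])` (unramified), in the verbatim shape of the `hQ` hypothesis of `convCoeff_eq_zero_of_qTermIdentityPk`
(`R := ℤ/p^k`, `ι := id`, `ι' := ι`, `τq := t₀`, `Frq := Fr`); the unit `u` depends only on the local data at `q`.
[cite: MazurRubin2004, Prop. 1.3.2 (p. 12)] [cite: Rubin2011, Prop. 1.9.5 (p. 16)] -/
theorem exists_unit_qTermIdentityPk (hp : p ≠ 2)
    {e : M →+ M' →+ MuCarrier K (p ^ k₀)}
    (he : ∀ (g : absoluteGaloisGroup K) (a : M) (b : M'), e (ρ g a) (ρ' g b) = mu K (p ^ k₀) g (e a b))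
    (hnd : ∀ b : M', (∀ a : M, e a b = 0) → b = 0)
    (hsurj : ∀ χ : M →+ MuCarrier K (p ^ k₀), ∃ b : M', ∀ a, e a b = χ a)
    (ι : MuCarrier K (p ^ k₀) →+ ZMod (p ^ k₀)) (hι : Function.Injective ι)
    {v₀ : M} {w₀ : M'} (h1 : ι (e v₀ w₀) = 1)
    (hunr : GaloisRep.IsUnramifiedAt q ρ) (hunr' : GaloisRep.IsUnramifiedAt q ρ')
    (hqp : (p : 𝓞 K) ∉ q.asIdeal) (hpl : p ^ k₀ ∣ Ideal.absNorm q.asIdeal - 1)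
    (hχI : ∀ u : (ZMod (Ideal.absNorm q.asIdeal))ˣ, ∃ t ∈ absInertia (q.adicCompletion K),
      modPCyclotomicCharacterZMod (q.adicCompletion K) (Ideal.absNorm q.asIdeal) t = u)
    {Fr : absoluteGaloisGroup (q.adicCompletion K)} (hFr : IsAbsArithFrob Fr)
    (hsplit : ρ (absGaloisRestrict K (q.adicCompletion K) Fr) = 1)
    (hsplit' : ρ' (absGaloisRestrict K (q.adicCompletion K) Fr) = 1) {m : ℕ} (hm : m + 1 ≤ J) (hk₀ : 1 ≤ k₀)
    (hFrm : absGaloisRestrict K (q.adicCompletion K) Fr ∈ κ.layerSubgroup m)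
    (hFrm' : absGaloisRestrict K (q.adicCompletion K) Fr ∉ κ.layerSubgroup (m + 1))
    {t₀ : absoluteGaloisGroup (q.adicCompletion K)} (ht₀ : t₀ ∈ absInertia (q.adicCompletion K))
    (hgen : ∀ u : (ZMod (Ideal.absNorm q.asIdeal))ˣ,
      u ∈ Subgroup.zpowers (modPCyclotomicCharacterZMod (q.adicCompletion K) (Ideal.absNorm q.asIdeal) t₀))
    (inv : LocalInvariants K (p ^ k₀)) (hperf : inv.IsPerfect)
    {g h : ℤ[X]} (hg : g.Monic) (hdeg : p ^ m + g.natDegree = J)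
    (hrel : g * ((X + 1 : ℤ[X]) ^ p ^ m - 1) + ((p ^ k₀ : ℕ) : ℤ[X]) * h = X ^ J) :
    ∃ u : ℕ → ZMod (p ^ k₀), IsUnit (u 0) ∧
      ∀ (c : contOneCocycles (κ.twistModPk ρ hM J).toTopRep),
        galoisCohomology.localization (κ.twistModPk ρ hM J) (Sum.inr q) 1
            (oneCocycleClass (κ.twistModPk ρ hM J).toTopRep c) ∈
          DiscreteGaloisModule.transverseSubgroup (GaloisRep.toLocal q (κ.twistModPk ρ hM J))
            (CyclotomicField (Ideal.absNorm q.asIdeal) (q.adicCompletion K)) →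
      ∀ (Ψc : contOneCocycles (κ.invTwist.twistModPk ρ' hM' J).toTopRep),
        galoisCohomology.localization (κ.invTwist.twistModPk ρ' hM' J) (Sum.inr q) 1
            (oneCocycleClass (κ.invTwist.twistModPk ρ' hM' J).toTopRep Ψc) ∈
          DiscreteGaloisModule.unramifiedSubgroup (GaloisRep.toLocal q (κ.invTwist.twistModPk ρ' hM' J)) 1 →
      ∀ (ε j : ℕ), j < J →
        (AddMonoidHom.id (ZMod (p ^ k₀))) (inv (Sum.inr q)
          (((κ.twistContPairingPk ρ ρ' (mu K (p ^ k₀)) hM hM' J he).restrict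
              (absGaloisRestrict K (Place.Completion (Sum.inr q : Place K)))).cupProduct
            ((galoisCohomology.map ((κ.twistModPkShift ρ hM J).restrictField (q.adicCompletion K)) 1)^[J - 1 - j]
              (galoisCohomology.localization (κ.twistModPk ρ hM J) (Sum.inr q) 1
                (oneCocycleClass (κ.twistModPk ρ hM J).toTopRep c)))
            (galoisCohomology.localization (κ.invTwist.twistModPk ρ' hM' J) (Sum.inr q) 1
              ((κ.invTwist.shiftH1Pk ρ' hM' J)^[ε]
                (oneCocycleClass (κ.invTwist.twistModPk ρ' hM' J).toTopRep Ψc))))) =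
        ∑ j' ∈ range (j + 1), u j' * ι (convCoeff e J (j - j')
          (c.1 (absGaloisRestrict K (q.adicCompletion K) t₀))
          ((shiftEnd M' J ^ ε) (Ψc.1 (absGaloisRestrict K (q.adicCompletion K) Fr)))) := by
  classical
  haveI : LocallyCompactSpace (absoluteGaloisGroup (q.adicCompletion K)) :=
    ‹LocallyCompactSpace (absoluteGaloisGroup (Place.Completion (Sum.inr q : Place K)))›
  obtain ⟨u, hu0, hu⟩ := exists_unit_inv_cupProduct_eq_sum_convCoeff_pk ρ ρ' hM hM' κ J q hp he hnd hsurj ι hι h1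
    hunr hunr' hqp hpl hχI hFr hsplit hsplit' hm hk₀ hFrm hFrm' ht₀ hgen inv hperf
    ((κ.twistContPairingPk ρ ρ' (mu K (p ^ k₀)) hM hM' J he).restrict
      (absGaloisRestrict K (Place.Completion (Sum.inr q : Place K))))
    (fun _ _ => rfl) ((κ.twistModPkShift ρ hM J).restrictField (q.adicCompletion K)) (fun _ => rfl) hg hdeg hrel
  refine ⟨u, hu0, fun c hc Ψc hΨ ε j hj => ?_⟩
  have hI' : ∀ t ∈ absInertia (q.adicCompletion K), ∀ y : Fin J → M',
      GaloisRep.toLocal q (κ.invTwist.twistModPk ρ' hM' J) t y = y :=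
    fun _ ht y => toLocal_twistModPk_apply_of_mem_absInertia κ.invTwist ρ' hM' J q hunr' hqp ht y
  -- the local classes are classes of explicit local cocycles
  rw [StepFour.localization_oneCocycleClass (κ.twistModPk ρ hM J) q c] at hc ⊢
  rw [StepFour.localization_oneCocycleClass (κ.invTwist.twistModPk ρ' hM' J) q Ψc] at hΨ
  rw [shiftH1Pk_iterate_oneCocycleClass, StepFour.localization_oneCocycleClass (κ.invTwist.twistModPk ρ' hM' J) q]
  have hΨ0 : ∀ t ∈ absInertia (q.adicCompletion K),
      (contOneCocycles.pullback (absGaloisRestrict K (q.adicCompletion K))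
        (X := (κ.invTwist.twistModPk ρ' hM' J).toTopRep)
        (Y := (GaloisRep.toLocal q (κ.invTwist.twistModPk ρ' hM' J)).toTopRep)
        (TopRep.ofHom ⟨ContinuousLinearMap.id ℤ (Fin J → M'), fun _ => rfl⟩) Ψc).1 t = 0 :=
    (X11b.LocBridge.mem_unramifiedSubgroup_one_iff_forall_eq_zero _ hI' _).1 hΨ
  have hψ : ∀ t ∈ absInertia (q.adicCompletion K),
      (contOneCocycles.pullback (absGaloisRestrict K (q.adicCompletion K))
        (X := (κ.invTwist.twistModPk ρ' hM' J).toTopRep)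
        (Y := (GaloisRep.toLocal q (κ.invTwist.twistModPk ρ' hM' J)).toTopRep)
        (TopRep.ofHom ⟨ContinuousLinearMap.id ℤ (Fin J → M'), fun _ => rfl⟩)
        (κ.invTwist.shiftPowCocyclePk ρ' hM' J ε Ψc)).1 t = 0 := by
    intro t ht
    have h0 := hΨ0 t ht
    rw [StepFour.pullback_absGaloisRestrict_apply] at h0 ⊢
    rw [shiftPowCocyclePk_apply, h0, map_zero]
  have hmain := hu j hj _ _ hc hψ
  rw [StepFour.pullback_absGaloisRestrict_apply, StepFour.pullback_absGaloisRestrict_apply, shiftPowCocyclePk_apply]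
    at hmain
  exact hmain

end Adapter

/-! ## §2 `hLocalPk`: STEP 4 + Lemma 1 (iii) joined, at `J = 2p^m k` -/

section Local

set_option maxHeartbeats 800000 in
/-- **The level-`p^k` local vanishing theorem (`hLocalPk`)** — VERBATIM the hypothesis of
`…KolyvaginReciprocityPkOfLocal.kolyvaginReciprocityPk_of_localPk`: for a global cocycle `c` of `𝒯_J^{(k)} = κ.twistModPk ρ hM J`
unramified off `S ∪ {q}` and TRANSVERSE at `q`, and a global cocycle `Ψc` of `𝒯′_J^{(k)}` unramified off `S` with
`loc_v(T^ε[Ψc]) = 0` on `S`, at an `E`-split arithmetic Frobenius `Fr` of `K_q` of depth `m` and a tame generator `t₀`,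
`J = 2p^m k`: **`C_i(c(res t₀), Ψc(res Fr)) = 0` for every `i + ε < J`** (Poitou–Tate for `inv` +
`exists_unit_qTermIdentityPk`; `k = 0` is the trivial module). [cite: MazurRubin2004, Prop. 1.3.2 and §4.4]
[cite: MilneADT2006, Ch. I, Thm. 4.10(b)] -/
theorem localPk {K : Type} [Field K] [NumberField K] {p : ℕ} [Fact p.Prime] {k : ℕ}
      {M M' : Type} [AddCommGroup M] [TopologicalSpace M] [DiscreteTopology M] [Finite M]
      [AddCommGroup M'] [TopologicalSpace M'] [DiscreteTopology M'] [Finite M']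
      (ρ : DiscreteGaloisModule K M) (ρ' : DiscreteGaloisModule K M')
      (hM : ∀ x : M, p ^ k • x = 0) (hM' : ∀ x : M', p ^ k • x = 0) (κ : ZpExtension K p) (J : ℕ)
      (q : HeightOneSpectrum (𝓞 K)) [Fact (Ideal.absNorm q.asIdeal).Prime]
      [NeZero ((Ideal.absNorm q.asIdeal : ℕ) : q.adicCompletion K)]
      [LocallyCompactSpace (absoluteGaloisGroup K)]
      [LocallyCompactSpace (absoluteGaloisGroup (Place.Completion (Sum.inr q : Place K)))] :
      p ≠ 2 →
      ∀ {e : M →+ M' →+ DiscreteGaloisModule.MuCarrier K (p ^ k)},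
      (∀ (g : absoluteGaloisGroup K) (a : M) (b : M'),
        e (ρ g a) (ρ' g b) = DiscreteGaloisModule.mu K (p ^ k) g (e a b)) →
      (∀ b : M', (∀ a : M, e a b = 0) → b = 0) →
      (∀ χ : M →+ DiscreteGaloisModule.MuCarrier K (p ^ k), ∃ b : M', ∀ a, e a b = χ a) →
      ∀ (ι : DiscreteGaloisModule.MuCarrier K (p ^ k) →+ ZMod (p ^ k)), Function.Injective ι →
      ∀ {v₀ : M} {w₀ : M'}, ι (e v₀ w₀) = 1 →
      ∀ {inv : LocalInvariants K (p ^ k)}, inv.IsPerfect → inv.SumLocalTermEqZero →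
      ∀ (S : Set (HeightOneSpectrum (𝓞 K))), q ∉ S →
      (∀ v ∉ S, ((p : ℕ) : 𝓞 K) ∉ v.asIdeal) → (∀ v ∉ S, GaloisRep.IsUnramifiedAt v ρ) →
      GaloisRep.IsUnramifiedAt q ρ' → p ^ k ∣ Ideal.absNorm q.asIdeal - 1 →
      (∀ u : (ZMod (Ideal.absNorm q.asIdeal))ˣ, ∃ t ∈ absInertia (q.adicCompletion K),
        modPCyclotomicCharacterZMod (q.adicCompletion K) (Ideal.absNorm q.asIdeal) t = u) →
      ∀ {Fr : absoluteGaloisGroup (q.adicCompletion K)}, IsAbsArithFrob Fr →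
      ρ (absGaloisRestrict K (q.adicCompletion K) Fr) = 1 →
      ρ' (absGaloisRestrict K (q.adicCompletion K) Fr) = 1 →
      ∀ {m : ℕ}, m + 1 ≤ J → J = 2 * p ^ m * k →
      absGaloisRestrict K (q.adicCompletion K) Fr ∈ κ.layerSubgroup m →
      absGaloisRestrict K (q.adicCompletion K) Fr ∉ κ.layerSubgroup (m + 1) →
      ∀ {t₀ : absoluteGaloisGroup (q.adicCompletion K)}, t₀ ∈ absInertia (q.adicCompletion K) →
      (∀ u : (ZMod (Ideal.absNorm q.asIdeal))ˣ,
        u ∈ Subgroup.zpowers (modPCyclotomicCharacterZMod (q.adicCompletion K) (Ideal.absNorm q.asIdeal) t₀)) →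
      ∀ (c : contOneCocycles (κ.twistModPk ρ hM J).toTopRep),
      (∀ v ∉ S, v ≠ q → galoisCohomology.localization (κ.twistModPk ρ hM J) (Sum.inr v) 1
          (oneCocycleClass (κ.twistModPk ρ hM J).toTopRep c) ∈
        DiscreteGaloisModule.unramifiedSubgroup (GaloisRep.toLocal v (κ.twistModPk ρ hM J)) 1) →
      galoisCohomology.localization (κ.twistModPk ρ hM J) (Sum.inr q) 1
          (oneCocycleClass (κ.twistModPk ρ hM J).toTopRep c) ∈
        DiscreteGaloisModule.transverseSubgroup (GaloisRep.toLocal q (κ.twistModPk ρ hM J))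
          (CyclotomicField (Ideal.absNorm q.asIdeal) (q.adicCompletion K)) →
      ∀ (Ψc : contOneCocycles (κ.invTwist.twistModPk ρ' hM' J).toTopRep),
      (∀ v ∉ S, galoisCohomology.localization (κ.invTwist.twistModPk ρ' hM' J) (Sum.inr v) 1
          (oneCocycleClass (κ.invTwist.twistModPk ρ' hM' J).toTopRep Ψc) ∈
        DiscreteGaloisModule.unramifiedSubgroup (GaloisRep.toLocal v (κ.invTwist.twistModPk ρ' hM' J)) 1) →
      ∀ (ε : ℕ),
      (∀ v ∈ S, galoisCohomology.localization (κ.invTwist.twistModPk ρ' hM' J) (Sum.inr v) 1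
        ((κ.invTwist.shiftH1Pk ρ' hM' J)^[ε] (oneCocycleClass (κ.invTwist.twistModPk ρ' hM' J).toTopRep Ψc)) = 0) →
      ∀ i, i + ε < J → convCoeff e J i (c.1 (absGaloisRestrict K (q.adicCompletion K) t₀))
        (Ψc.1 (absGaloisRestrict K (q.adicCompletion K) Fr)) = 0 := by
  intro hp e he hnd hsurj ι hι v₀ w₀ h1 inv hperf hPT S hq hSp hur hunr' hpl hχI Fr hFr hsplit hsplit' m hm hJ hFrm
    hFrm' t₀ ht₀ hgen c hx hcq Ψc hΨ ε hΨS i hi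
  have hpP : p.Prime := Fact.out
  rcases Nat.eq_zero_or_pos k with hk0 | hk
  · -- `k = 0`: the dual module is trivial
    subst hk0
    have hy : Ψc.1 (absGaloisRestrict K (q.adicCompletion K) Fr) = 0 := by
      funext l
      have := hM' (Ψc.1 (absGaloisRestrict K (q.adicCompletion K) Fr) l)
      rwa [pow_zero, one_smul] at this
    rw [hy, convCoeff_zero_right]
  obtain ⟨g, h, hg, hdeg, hrel⟩ := exists_monic_rel hpP m k hk
  rw [← hJ] at hdeg hrel
  obtain ⟨u, hu0, hu⟩ := exists_unit_qTermIdentityPk ρ ρ' hM hM' κ J q hp he hnd hsurj ι hι h1 (hur q hq) hunr'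
    (hSp q hq) hpl hχI hFr hsplit hsplit' hm hk hFrm hFrm' ht₀ hgen inv hperf hg hdeg hrel
  exact convCoeff_eq_zero_of_qTermIdentityPk κ ρ ρ' hM hM' J he hp hk hPT S q hq hSp hur c hx Ψc hΨ ε hΨS
    t₀ Fr (AddMonoidHom.id (ZMod (p ^ k))) ι hι u hu0 (fun j hj => hu c hcq Ψc (hΨ q hq) ε j hj) i hi

end Local

end Summit.BirchSwinnertonDyer.BirchSwinnertonDyer.Theorems.OneSidedTwistSqueezeX9KatoDivisibilityX9ReciprocityPkLocal

end
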